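import Mathlib
import HarnessLib
import Summits.HubbardSuperconductivity.HubbardSuperconductivity.Theorems.KLProgrammeKLRegimeTwoVolumeTowerBaseSrcBlockRows
import Summits.HubbardSuperconductivity.HubbardSuperconductivity.Theorems.KLProgrammeKLRegimeTwoVolumeTowerBaseTransferFrameDiff

/-!
# Route `KLProgramme` — crux K3, VL child `KLRegimeVolumeLimitV17F2` (stmt-HubbardSuperconductivity-20440), base of the two-volume tower:
# THE SOURCE ROWS OF THE BASE TRANSFER ARE UNBOUNDED IN `M` — the row clause of atom `Hbase` (DISCHARGER-GUIDE-g16 §2) has no witness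
# (located defect «BASE-SRC-ROWS», eventual-in-`M` form; cell gate-hubbard-kl, seat p3 g18; `--supports` 20440)

Continuation of `…TowerBaseSrcBlockRows` (p641676: exact row `(1/2M)·Σ_d ‖Σ_{j<2M} χ_j(d)‖ ≥ 1 + log(2M+1)/π` of the plain source block
`klSrcPlainBlock·S_{4M}`).  The suppliers' atoms of the VL child quantify «`∃` constants, `∃ M₀`, `∀ M ≥ M₀`»; this file states the negative
knowledge in exactly that shape and in the currency of the base transfer `klBaseTransfer` (whose copy-`1` rows ARE the source-block rows,
`klBaseTransfer_apply_one_one/_one_zero`):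

* `exists_srcBlock_wtRow_gt` — every `M ≥ exp(π(|C|+1))` has a row label whose weighted source row exceeds `C`;
* **`not_exists_eventually_uniform_srcBlock_rowBound`** — no `C, M₀` bound the weighted source rows for all `M ≥ M₀`;
* `klBaseTransfer_srcCopy_wtRow_eq` — the weighted row of `klBaseTransfer V M β μ K` at a source-copy label `(Y, 1)` is the weighted source row (any frame);
* **`not_exists_eventually_uniform_baseTransfer_rowBound`** — for every volume `V`, `β ≠ 0`, `μ`, every `M`-indexed frame `K M` and rate `Λ_T ≥ 0`:
  no `cgW, M₀` with `Σ_y ‖klBaseTransfer V M β μ (K M) x y‖·(1 + Λ_T·tnorm(x.1.1.2 − y.1.1.1.2)) ≤ cgW` for all `M ≥ M₀`, all `x : SrcLabel V M 0` —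
  the literal row clause of `towerBase_transferData_of_atoms` / `tower_base_keyedDefect_eventually_le` (`hdata`) / `exists_towerDataTS_of_readouts`
  (`hdataT`) / atom `Hbase`, at the source-copy labels.  Nothing is claimed about the premises (`TowerP …`) of `Hbase`.

Proofs only; no definition; no sorry.  Honest framing: negative knowledge about ONE binder of a helper interface; it refutes no stub of 20440, K3 or VL.
[cite: BenfattoGiulianiMastropietro2006, §2.7 (2.70)–(2.71a)]
-/

noncomputable section

namespace Summit.HubbardSuperconductivity.HubbardSuperconductivity.Theorems.TwoVolumeSource

set_option linter.dupNamespace false -- summit = problem name (single-conjunct summit), D-0017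

open Finset Complex Literature.MathematicalPhysics.QuantumLattice GrassmannAlgebra Literature.Probability.LatticeModels
open Summit.HubbardSuperconductivity.HubbardSuperconductivity.Theorems.KLProgrammeLegKernels
open Summit.HubbardSuperconductivity.HubbardSuperconductivity.Theorems.KLRegimeSplit
open Summit.HubbardSuperconductivity.HubbardSuperconductivity.Theorems.EngineV8
open Summit.HubbardSuperconductivity.HubbardSuperconductivity.Theorems.TwoVolumeDefect
open scoped ComplexConjugate Real

/-! ## The eventual-in-`M` form and the base-transfer currency of atom `Hbase` (DISCHARGER-GUIDE-g16 §2) -/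

section Eventually

variable {V : ℕ} [NeZero V]

/-- **A large time cutoff produces a large source row**: for `β ≠ 0`, `Λ_T ≥ 0`, any `C` and every `M ≥ exp(π(|C|+1))` there is a row label `Y` whose
`(1 + Λ_T·tnorm)`-weighted source-block row exceeds `C`. [cite: BenfattoGiulianiMastropietro2006, §2.7 (2.71a)] -/
theorem exists_srcBlock_wtRow_gt {β : ℝ} (hβ : β ≠ 0) {ΛT : ℝ} (hΛT : 0 ≤ ΛT) (C : ℝ) (M : ℕ) [NeZero M] (hM : Real.exp (π * (|C| + 1)) ≤ M) :
    ∃ Y : SpaceTimeIdx V M × SectorLeg (sectorCount 0),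
      C < ∑ y : GridLeg (GridPoint V (klGridN M)), ‖(klSrcPlainBlock V M β * hubbardGridSub V M β (klGridN M)) Y y‖ *
        (1 + ΛT * (Torus.tnorm (Y.1.2 - y.1.1.2) : ℝ)) := by
  have hM2 : 0 < 2 * M := by have := NeZero.ne M; omega
  have hs : 0 < sectorCount 0 := by simp [sectorCount]
  set ω : Fin (sectorCount 0) := ⟨0, hs⟩ with hω'
  have hω : (ω : ℕ) = 0 := rfl
  set x₀ : SpaceTimeIdx V M := (⟨0, hM2⟩, 0) with hx₀
  refine ⟨(x₀, ((ω, 0), 0)), ?_⟩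
  have hunw : ∑ y : GridLeg (GridPoint V (klGridN M)), ‖(klSrcPlainBlock V M β * hubbardGridSub V M β (klGridN M)) (x₀, ((ω, 0), 0)) y‖ ≤
      ∑ y : GridLeg (GridPoint V (klGridN M)), ‖(klSrcPlainBlock V M β * hubbardGridSub V M β (klGridN M)) (x₀, ((ω, 0), 0)) y‖ *
        (1 + ΛT * (Torus.tnorm ((x₀, (((ω, (0 : Fin 2)), (0 : Fin 2)) : SectorLeg (sectorCount 0))).1.2 - y.1.1.2) : ℝ)) :=
    Finset.sum_le_sum fun y _ => le_mul_of_one_le_right (norm_nonneg _) (by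
      have : (0 : ℝ) ≤ (Torus.tnorm ((x₀, (((ω, (0 : Fin 2)), (0 : Fin 2)) : SectorLeg (sectorCount 0))).1.2 - y.1.1.2) : ℝ) := Nat.cast_nonneg _
      nlinarith)
  have hlog := srcBlock_row_ge_log hβ x₀ ω hω 0
  have hM0 : (0 : ℝ) < M := Nat.cast_pos.2 (Nat.pos_of_ne_zero (NeZero.ne M))
  have hlogM : π * (|C| + 1) ≤ Real.log (2 * (M : ℝ) + 1) := by
    rw [← Real.log_exp (π * (|C| + 1))]
    exact Real.log_le_log (Real.exp_pos _) (by linarith)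
  have hπ := Real.pi_pos
  have hdiv : |C| + 1 ≤ Real.log (2 * (M : ℝ) + 1) / π := by
    rw [le_div_iff₀ hπ]
    linarith
  linarith [le_abs_self C]

/-- **NO EVENTUALLY-`M`-UNIFORM ROW BOUND FOR THE PLAIN SOURCE BLOCK**: for every volume `V`, `β ≠ 0`, rate `Λ_T ≥ 0` there are no `C`, `M₀` with
`Σ_y ‖(klSrcPlainBlock V M β·S_{4M}) Y y‖·(1 + Λ_T·tnorm(x⃗_Y − x⃗_y)) ≤ C` for all `M ≥ M₀` and all rows `Y` — the «for all large `M`» binder shape of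
the suppliers' atoms. [cite: BenfattoGiulianiMastropietro2006, §2.7 (2.70)–(2.71a)] -/
theorem not_exists_eventually_uniform_srcBlock_rowBound (V : ℕ) [NeZero V] {β : ℝ} (hβ : β ≠ 0) {ΛT : ℝ} (hΛT : 0 ≤ ΛT) :
    ¬ ∃ C : ℝ, ∃ M₀ : ℕ, ∀ (M : ℕ) [NeZero M], M₀ ≤ M → ∀ Y : SpaceTimeIdx V M × SectorLeg (sectorCount 0),
      ∑ y : GridLeg (GridPoint V (klGridN M)), ‖(klSrcPlainBlock V M β * hubbardGridSub V M β (klGridN M)) Y y‖ *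
        (1 + ΛT * (Torus.tnorm (Y.1.2 - y.1.1.2) : ℝ)) ≤ C := by
  rintro ⟨C, M₀, hC⟩
  set M : ℕ := max M₀ (⌈Real.exp (π * (|C| + 1))⌉₊ + 1) with hM
  haveI : NeZero M := ⟨by rw [hM]; omega⟩
  have hM₀ : M₀ ≤ M := le_max_left _ _
  have hMge : Real.exp (π * (|C| + 1)) ≤ (M : ℝ) := by
    have h1 := Nat.le_ceil (Real.exp (π * (|C| + 1)))
    have h2 : (⌈Real.exp (π * (|C| + 1))⌉₊ + 1 : ℕ) ≤ M := le_max_right _ _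
    have h3 : ((⌈Real.exp (π * (|C| + 1))⌉₊ + 1 : ℕ) : ℝ) ≤ (M : ℝ) := by exact_mod_cast h2
    push_cast at h3
    linarith
  obtain ⟨Y, hY⟩ := exists_srcBlock_wtRow_gt (V := V) hβ hΛT C M hMge
  exact absurd (hC M hM₀ Y) (not_le.2 hY)

/-- **The weighted row of the base transfer at a SOURCE-copy label is the weighted row of the plain source block** (whatever the frame `K`).
[cite: BenfattoGiulianiMastropietro2006, §2.7 (2.71)] -/
theorem klBaseTransfer_srcCopy_wtRow_eq {M : ℕ} (β μ : ℝ) (K : TrigPolyC4v) (ΛT : ℝ) (Y : SpaceTimeIdx V M × SectorLeg (sectorCount 0)) :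
    ∑ y : GridLeg (GridPoint V (klGridN M)) × Fin 2, ‖klBaseTransfer V M β μ K (Y, 1) y‖ * (1 + ΛT * (Torus.tnorm (Y.1.2 - y.1.1.1.2) : ℝ)) =
      ∑ y : GridLeg (GridPoint V (klGridN M)), ‖(klSrcPlainBlock V M β * hubbardGridSub V M β (klGridN M)) Y y‖ *
        (1 + ΛT * (Torus.tnorm (Y.1.2 - y.1.1.2) : ℝ)) := by
  rw [Fintype.sum_prod_type]
  refine Finset.sum_congr rfl fun y _ => ?_
  rw [Fin.sum_univ_two, klBaseTransfer_apply_one_zero, klBaseTransfer_apply_one_one, norm_zero, zero_mul, zero_add]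

/-- **CONJUNCT 1 OF ATOM `Hbase` HAS NO WITNESS AT ANY FIXED VOLUME**: for every volume `V`, `β ≠ 0`, `μ`, every `M`-indexed frame `K M`
(e.g. `K M = klFlowFrameU L M β U μ (nScales β + 1)`) and every rate `Λ_T ≥ 0`, there are no `cgW`, `M₀` with
`Σ_y ‖klBaseTransfer V M β μ (K M) x y‖·(1 + Λ_T·tnorm(x.1.1.2 − y.1.1.1.2)) ≤ cgW` for all `M ≥ M₀` and all labels `x : SrcLabel V M 0` — the literal
row clause of the base-transfer bundle (`towerBase_transferData_of_atoms`, `tower_base_keyedDefect_eventually_le` `hdata`, `exists_towerDataTS_of_readouts`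
`hdataT`, DISCHARGER-GUIDE-g16 `Hbase`) fails at the source-copy labels.  (Nothing about the premises `TowerP …` of `Hbase` is claimed.)
[cite: BenfattoGiulianiMastropietro2006, §2.7 (2.70)–(2.71a)] -/
theorem not_exists_eventually_uniform_baseTransfer_rowBound (V : ℕ) [NeZero V] {β : ℝ} (hβ : β ≠ 0) (μ : ℝ) (K : ℕ → TrigPolyC4v)
    {ΛT : ℝ} (hΛT : 0 ≤ ΛT) :
    ¬ ∃ cgW : ℝ, ∃ M₀ : ℕ, ∀ (M : ℕ) [NeZero M], M₀ ≤ M → ∀ x : SrcLabel V M 0,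
      ∑ y : GridLeg (GridPoint V (klGridN M)) × Fin 2, ‖klBaseTransfer V M β μ (K M) x y‖ * (1 + ΛT * (Torus.tnorm (x.1.1.2 - y.1.1.1.2) : ℝ)) ≤ cgW := by
  rintro ⟨C, M₀, hC⟩
  refine not_exists_eventually_uniform_srcBlock_rowBound V hβ hΛT ⟨C, M₀, fun M _ hM Y => ?_⟩
  have h := hC M hM (Y, 1)
  rwa [klBaseTransfer_srcCopy_wtRow_eq] at h

end Eventually

end Summit.HubbardSuperconductivity.HubbardSuperconductivity.Theorems.TwoVolumeSource

end
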